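import Literature.NumberTheory.LFunctions.LogDerivRectangleResidues
import Literature.NumberTheory.LFunctions.CharZeroSum
import HarnessLib

/-!
# The non-trivial zeros of an entire function as an index type: truncations and `Σ m(ρ)/(1 + γ²) < ∞`

Topic `Literature/NumberTheory/LFunctions`, sub-namespace `EntireEF`. Everything here is PROVED;
the two definitions (`nontrivialZeros`, `zeroFinset`) are glue. This is the abstract form of the
tree's `ExplicitPsiChar.charNontrivialZeros` / `charZeroFinset` / `summable_zeroOrder_div_one_add_sq`
(`CharZeroSum.lean`), for an entire `f` not identically zero whose zeros obey a window bound

  `Σ_{ρ ∈ P} m(ρ) ≤ W · (A + log(|τ| + 4))`  for finite sets `P` of zeros with `0 < β < 1`, `|γ − τ| ≤ 1/2`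

(as the tree provides for Dirichlet `L`-functions, and `ClassGroupLFunctionWindows` for `L₀(s, χ)` and
`ζ_K`): `nontrivialZeros f`, `zeroFinset`, `tendsto_zeroFinset`, `sum_zeroFinset_eq`,
`summable_analyticOrderNatAt_div_one_add_sq` (**`Σ_ρ m(ρ)/(1 + γ²) < ∞`**) and the comparison
`summable_of_norm_le_mul_div`.

## References

* H. L. Montgomery, R. C. Vaughan, *Multiplicative Number Theory I*, Thm. 10.17. [MontgomeryVaughan2007]
-/

noncomputable section

open Complex Filter Topology Set Finset

namespace Literature.NumberTheory.LFunctions.EntireEF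

open Literature.Analysis.Complex

variable {f : ℂ → ℂ}

/-! ### The set of non-trivial zeros and its truncations -/

/-- The zeros of `f` in the open critical strip: `f(ρ) = 0`, `0 < Re ρ < 1`. [folklore] -/
def nontrivialZeros (f : ℂ → ℂ) : Set ℂ := {ρ | f ρ = 0 ∧ 0 < ρ.re ∧ ρ.re < 1}

/-- Membership. [folklore] -/
theorem mem_nontrivialZeros {ρ : ℂ} : ρ ∈ nontrivialZeros f ↔ f ρ = 0 ∧ 0 < ρ.re ∧ ρ.re < 1 := Iff.rfl

/-- The truncation `|Im ρ| ≤ T` is finite (entire `f` with `f(c) ≠ 0`). [folklore] -/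
theorem finite_nontrivialZeros_inter (hf : Differentiable ℂ f) {c : ℂ} (hc : f c ≠ 0) (T : ℝ) :
    (nontrivialZeros f ∩ {ρ | |ρ.im| ≤ T}).Finite := by
  refine (finite_zeros_of_entire hf hc ((isCompact_Icc (a := (0:ℝ)) (b := 1)).reProdIm
    (isCompact_Icc (a := -T) (b := T)))).subset ?_
  rintro ρ ⟨⟨h0, h1, h2⟩, h3⟩
  exact ⟨Complex.mem_reProdIm.2 ⟨⟨h1.le, h2.le⟩, abs_le.1 h3⟩, h0⟩

/-- The zeros with `|Im ρ| ≤ T`, inside the subtype, as a `Finset`. [folklore] -/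
def zeroFinset (hf : Differentiable ℂ f) {c : ℂ} (hc : f c ≠ 0) (T : ℝ) : Finset (nontrivialZeros f) :=
  (((finite_nontrivialZeros_inter hf hc T).preimage Subtype.val_injective.injOn)).toFinset

/-- Membership in `zeroFinset` is `|Im ρ| ≤ T`. [folklore] -/
theorem mem_zeroFinset {hf : Differentiable ℂ f} {c : ℂ} {hc : f c ≠ 0} {T : ℝ} {ρ : nontrivialZeros f} :
    ρ ∈ zeroFinset hf hc T ↔ |(ρ : ℂ).im| ≤ T := by
  simp only [zeroFinset, Set.Finite.mem_toFinset, Set.mem_preimage, Set.mem_inter_iff, Set.mem_setOf_eq,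
    Subtype.coe_prop, true_and]

/-- The truncations exhaust. [folklore] -/
theorem tendsto_zeroFinset (hf : Differentiable ℂ f) {c : ℂ} (hc : f c ≠ 0) :
    Tendsto (zeroFinset hf hc) atTop atTop := by
  refine tendsto_atTop.2 fun s => ?_
  filter_upwards [eventually_ge_atTop (∑ ρ ∈ s, |(ρ : ℂ).im|)] with T hT
  intro ρ hρ
  rw [mem_zeroFinset]
  exact (Finset.single_le_sum (f := fun ρ : nontrivialZeros f => |(ρ : ℂ).im|) (fun ρ _ => abs_nonneg _) hρ).trans hT

/-- Sums over `zeroFinset hf hc T` are `Finset` sums over the finite box. [folklore] -/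
theorem sum_zeroFinset_eq {M : Type*} [AddCommMonoid M] (hf : Differentiable ℂ f) {c : ℂ} (hc : f c ≠ 0)
    (T : ℝ) (F : ℂ → M) :
    ∑ ρ ∈ zeroFinset hf hc T, F ρ = ∑ z ∈ (finite_nontrivialZeros_inter hf hc T).toFinset, F z := by
  classical
  have e : ∑ ρ ∈ zeroFinset hf hc T, F ρ = ∑ z ∈ (zeroFinset hf hc T).map (Function.Embedding.subtype _), F z := by
    rw [Finset.sum_map]; rfl
  rw [e]
  refine Finset.sum_congr ?_ fun _ _ => rfl
  ext z
  simp only [Finset.mem_map, Function.Embedding.subtype_apply, Set.Finite.mem_toFinset]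
  constructor
  · rintro ⟨ρ, hρ, rfl⟩
    exact ⟨ρ.2, mem_zeroFinset.1 hρ⟩
  · intro hz
    exact ⟨⟨z, hz.1⟩, mem_zeroFinset.2 hz.2, rfl⟩

/-! ### `Σ m(ρ)/(1 + γ²) < ∞` from a window bound -/

/-- **`Σ_ρ m(ρ)/(1 + γ²) < ∞`** over the non-trivial zeros of `f`, counted with multiplicity
`m = analyticOrderNatAt f`, whenever the zeros obey a window bound
`Σ_{ρ ∈ P} m(ρ) ≤ W (A + log(|τ| + 4))` (`P` finite sets of non-trivial zeros with `|γ − τ| ≤ 1/2`).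
[cite: MontgomeryVaughan2007, Theorem 10.17] -/
theorem summable_analyticOrderNatAt_div_one_add_sq {W A : ℝ} (hW : 0 ≤ W) (hA : 0 ≤ A)
    (hwin : ∀ (τ : ℝ) (P : Finset ℂ), (∀ ρ ∈ P, f ρ = 0 ∧ 0 < ρ.re ∧ ρ.re < 1 ∧ |ρ.im - τ| ≤ 1 / 2) →
      ∑ ρ ∈ P, (analyticOrderNatAt f ρ : ℝ) ≤ W * (A + Real.log (|τ| + 4))) :
    Summable fun ρ : nontrivialZeros f => (analyticOrderNatAt f (ρ : ℂ) : ℝ) / (1 + (ρ : ℂ).im ^ 2) := by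
  classical
  set g : ℤ → ℝ := fun k => 4 * W * ((A + Real.log (|(k : ℝ)| + 4)) / (1 + (k : ℝ) ^ 2)) with hg
  have hgsum : Summable g := (ExplicitPsiChar.summable_window_weight hA).mul_left (4 * W)
  have hg0 : ∀ k, 0 ≤ g k := fun k => by
    have : 0 ≤ Real.log (|(k : ℝ)| + 4) := Real.log_nonneg (by linarith [abs_nonneg (k : ℝ)])
    positivity
  refine summable_of_sum_le (fun ρ => by positivity) (c := ∑' k, g k) fun u => ?_
  set kf : nontrivialZeros f → ℤ := fun ρ => round ((ρ : ℂ).im) with hkf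
  rw [← Finset.sum_fiberwise_of_maps_to (g := kf) (fun ρ _ => Finset.mem_image_of_mem kf ‹_›)]
  refine (Finset.sum_le_sum fun k hk => ?_).trans (hgsum.sum_le_tsum _ (fun k _ => hg0 k))
  have hfib : ∀ ρ ∈ u.filter (fun ρ => kf ρ = k), |(ρ : ℂ).im - k| ≤ 1 / 2 := by
    intro ρ hρ
    have h := (Finset.mem_filter.1 hρ).2
    rw [hkf] at h
    rw [← h]
    exact abs_sub_round _
  have hwin' := hwin (k : ℝ) ((u.filter (fun ρ => kf ρ = k)).image Subtype.val) (by
    intro z hz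
    obtain ⟨ρ, hρ, rfl⟩ := Finset.mem_image.1 hz
    exact ⟨ρ.2.1, ρ.2.2.1, ρ.2.2.2, hfib ρ hρ⟩)
  rw [Finset.sum_image (fun a _ b _ h => Subtype.ext h)] at hwin'
  have hbound : ∀ ρ ∈ u.filter (fun ρ => kf ρ = k),
      (analyticOrderNatAt f (ρ : ℂ) : ℝ) / (1 + (ρ : ℂ).im ^ 2) ≤
        (4 / (1 + (k : ℝ) ^ 2)) * (analyticOrderNatAt f (ρ : ℂ) : ℝ) := by
    intro ρ hρ
    have h1 := hfib ρ hρ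
    have hden : 1 + (k : ℝ) ^ 2 ≤ 4 * (1 + (ρ : ℂ).im ^ 2) := by
      have h2 : |(k : ℝ)| ≤ |(ρ : ℂ).im| + 1 / 2 := by
        have := abs_sub_abs_le_abs_sub (k : ℝ) (ρ : ℂ).im
        rw [abs_sub_comm] at this
        linarith
      have h3 : (k : ℝ) ^ 2 ≤ (|(ρ : ℂ).im| + 1 / 2) ^ 2 := by
        rw [← sq_abs (k : ℝ)]; exact pow_le_pow_left₀ (abs_nonneg _) h2 2
      nlinarith [sq_nonneg (|(ρ : ℂ).im| - 1 / 2), sq_abs ((ρ : ℂ).im), abs_nonneg ((ρ : ℂ).im)]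
    rw [div_le_iff₀ (by positivity), mul_comm, ← mul_assoc]
    refine le_mul_of_one_le_left (Nat.cast_nonneg _) ?_
    rw [mul_div_assoc', one_le_div (by positivity)]
    linarith
  calc ∑ ρ ∈ u.filter (fun ρ => kf ρ = k), (analyticOrderNatAt f (ρ : ℂ) : ℝ) / (1 + (ρ : ℂ).im ^ 2)
      ≤ ∑ ρ ∈ u.filter (fun ρ => kf ρ = k), (4 / (1 + (k : ℝ) ^ 2)) * (analyticOrderNatAt f (ρ : ℂ) : ℝ) :=
        Finset.sum_le_sum hbound
    _ = (4 / (1 + (k : ℝ) ^ 2)) * ∑ ρ ∈ u.filter (fun ρ => kf ρ = k), (analyticOrderNatAt f (ρ : ℂ) : ℝ) := by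
        rw [Finset.mul_sum]
    _ ≤ (4 / (1 + (k : ℝ) ^ 2)) * (W * (A + Real.log (|(k : ℝ)| + 4))) :=
        mul_le_mul_of_nonneg_left hwin' (by positivity)
    _ = g k := by rw [hg]; ring

/-- Comparison: if `‖F ρ‖ ≤ B · m(ρ)/(1 + γ²)` then `Σ_ρ F ρ` converges absolutely. [folklore] -/
theorem summable_of_norm_le_mul_div {W A : ℝ} (hW : 0 ≤ W) (hA : 0 ≤ A)
    (hwin : ∀ (τ : ℝ) (P : Finset ℂ), (∀ ρ ∈ P, f ρ = 0 ∧ 0 < ρ.re ∧ ρ.re < 1 ∧ |ρ.im - τ| ≤ 1 / 2) →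
      ∑ ρ ∈ P, (analyticOrderNatAt f ρ : ℝ) ≤ W * (A + Real.log (|τ| + 4)))
    {B : ℝ} {F : nontrivialZeros f → ℂ}
    (hF : ∀ ρ, ‖F ρ‖ ≤ B * ((analyticOrderNatAt f (ρ : ℂ) : ℝ) / (1 + (ρ : ℂ).im ^ 2))) :
    Summable fun ρ => ‖F ρ‖ :=
  Summable.of_nonneg_of_le (fun _ => norm_nonneg _) hF
    ((summable_analyticOrderNatAt_div_one_add_sq hW hA hwin).mul_left B)

end Literature.NumberTheory.LFunctions.EntireEF

end
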